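import Summits.ResolutionOfSingularities.ResolutionOfSingularities.Theorems.EquisingularLiftEquisingularLiftNatDescentChain
import Summits.ResolutionOfSingularities.ResolutionOfSingularities.Theorems.EquisingularLiftEquisingularLiftNatResidueHypDefs
import Summits.ResolutionOfSingularities.ResolutionOfSingularities.Theorems.EquisingularLiftEquisingularLiftNatDescBase
import Summits.ResolutionOfSingularities.ResolutionOfSingularities.Theorems.EquisingularLiftEquisingularLiftProjectiveAmbientFibre
import Summits.ResolutionOfSingularities.ResolutionOfSingularities.Theorems.EquisingularLiftEquisingularLiftProjectiveAmbientSmoothProper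
import Summits.ResolutionOfSingularities.ResolutionOfSingularities.Theorems.EquisingularLiftEquisingularLiftGoodAtOfSmooth
import Literature.AlgebraicGeometry.Motives.ProjBaseChangeAny
import HarnessLib

/-!
# [OURS · L1 W4.5(b) · EL♮(3) · WIDTH TABLE D18 «DESCENT-CERTIFICATE DOOR», engine] ★★ `descDoor_elnat : DescDoor k n H ι → ELNatConclusionO k n H ι`

res-L1-w45b-nose-w1 g8 (WIDTH seat D-0157 DOOR 1; desk RULING R88-PRE 2026-08-29T13:59Z «nose-w1 g8 ENGINE SKETCH `descDoor_elnat` per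
(E0)–(E4) + RUNG shape `nose_desc_rung_three`»; letters = res-L1-w45b-idea-2 g32 `D18-LETTERS-idea2.md` v1.3 70e65a9db43b7957, typed by
res-type-027 g24 as `…NatResidueHypDefsE10` (`DescCentresSmoothOver`, `DescTransformOK`, `DescDoorOver`, `DescDoor`)).

WHAT.  The door `DescDoor k n H ι` is a DESCENT CERTIFICATE: an `N` invertible in `k` and a multiple blow-up `s : CentreSeq ℙⁿ_B`,
`B = ℤ[1/N]`, with `B`-FLAT exceptional divisors and `B`-SMOOTH centres, whose induced tower over the standard fibre `ℙⁿ_k → ℙⁿ_B`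
is an embedded-resolution word for `range ι` (`DescTransformOK`).  The engine turns it into the conclusion `ELNatConclusionO k n H ι`
of EL♮ — for EVERY `n`, with NO hypothesis on `H` and NO lifting Fact:
* (E0) `O := 𝕎(k)` (✓ `DescBase.exists_base`, res-L1-w45b-stub-2: ✓ `stub_wittRing` + `N ∈ Oˣ`), `g : B → O` the `IsLocalization.Away` lift;
* (E1) the TOP SQUARES: `ι_O := Proj.map (B[x] → O[x]) : ℙⁿ_O → ℙⁿ_B` is the base change of `Spec O → Spec B`
  (Literature ✓ `ProjBaseChangeRing.isPullback_projMap'`, arbitrary algebra), the crux's `j := Proj.map φ : ℙⁿ_k → ℙⁿ_O` is the base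
  change of `Spec π` (✓ `ProjectiveAmbientFibre.isPullback_projMap`), and `ι_k := j ≫ ι_O = Proj.map (φ ∘ (B[x] → O[x]))`
  (Mathlib `Proj.map_comp`) sits in the pasted square over `Spec (π ∘ g)` — so the door's `∀ θ φ` clause is CALLED at
  `θ := π ∘ g`, `φ := φ.comp (mapGraded B O)`;
* (E2)–(E5) ONE call of res-L1-w45b-stub-4's ✓ `Descent.chain_of_descTransformOK` (…NatDescentChain: the induction along `s` through
  the model squares, centres smooth over `Spec O` hence `O`-flat and regular, ✓ `Descent.modelStage'`, END transfer) with the stage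
  predicate `Ch := ⋂ Q` (the least predicate containing `(ℙⁿ_O, 𝟙, Y)` and closed under EL♮'s horizontal E1 step — K5′'s idiom), seed
  `σ' := 𝟙`, `σ_k := 𝟙`, `S' := Y = j '' range ι`, `T := Y₀ := range ι`.
Then `descDoor_elnat` = (E0) + `descDoorOver_elnat_of_base` (the `O`-uniform form: ANY local Noetherian `O` with `Spec O` regular, any
surjection `π : O → k`, any `B`-algebra structure on `O`).  OURS; NOT a statement of any manuscript ([Hironaka2017] is a candidate under
adjudication, nothing of it is asserted); AI-written, weaker than expert review.  DEF-FREE; no `sorry`; standard axioms; FACT-FREE (no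
`EmbeddedCurveLiftFact`).  `--supports stmt-ResolutionOfSingularities-20148 --as helper`, counted 0.  EL♮(3) is NOT proved here (the door
serves the RIGID SPECIMENS' class only — H-independent words, customer #4 = H₁₀ ⊃ Z₁₅); resolution of singularities in positive
characteristic is NOT proved anywhere in this tree (dim 3 in print: Cossart–Piltant 2008/2009).
[cite: Liu2002, Prop. 3.1.9 and Ex. 3.1.10] [cite: StacksProject, Tags 0805, 056P] (method; index only)
-/

set_option linter.dupNamespace false -- mandated namespace `Summit.<Summit>.<Problem>` of this single-conjunct summit
set_option linter.overlappingInstances false -- signatures carry `[IsDomain O] [IsDiscreteValuationRing O]`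

noncomputable section

open CategoryTheory CategoryTheory.Limits AlgebraicGeometry TopologicalSpace Topology IsLocalRing
open MvPolynomial
open Literature.AlgebraicGeometry.Resolution
open Literature.AlgebraicGeometry.Motives
open AlgebraicGeometry.Scheme.IdealSheafData
open Summit.ResolutionOfSingularities.ResolutionOfSingularities.Cruxes.EquisingularLift.StrataSplit

attribute [local instance] MvPolynomial.gradedAlgebra
attribute [local instance] Literature.AlgebraicGeometry.Motives.ProjBaseChange.algebraBase

namespace Summit.ResolutionOfSingularities.ResolutionOfSingularities.Cruxes.EquisingularLiftNat.Sections

/-- ★ **`descDoorOver_elnat_of_base` — the `O`-UNIFORM engine.**  For ANY base ring `B`, any local Noetherian `B`-algebra `O` with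
`Spec O` regular and any surjection `π : O → k` onto the field `k`: a descent certificate `DescDoorOver B k n H ι` yields, for every
graded lift `φ` of `π` and `Y = range (ι ≫ Proj.map φ)`, the tower-and-END clause of `ELNatConclusionO` over `O` (its part after the
`∃ O … π` binders).  Proof = (E1) three cartesian squares of projective spaces + ONE call of ✓ `Descent.chain_of_descTransformOK`
with `Ch := ⋂ Q`. [cite: Liu2002, Prop. 3.1.9 and Ex. 3.1.10] [OURS · L1 W4.5b · D18 engine]; NOT a statement of the manuscript. -/
theorem descDoorOver_elnat_of_base (B : Type) [CommRing B] (O : Type) [CommRing O] [IsLocalRing O] [IsNoetherianRing O]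
    [Algebra B O] (hOreg : Scheme.IsRegular (Spec (.of O)))
    (k : Type) [Field k] (π : O →+* k) (hπ : Function.Surjective π) (n : ℕ) (H : AlgebraicGeometry.Scheme.{0})
    (ι : H ⟶ (Literature.AlgebraicGeometry.Motives.projectiveSpace n k).left) (hD : DescDoorOver B k n H ι)
    (φ : MvPolynomial.homogeneousSubmodule (Fin (n + 1)) O →+*ᵍ MvPolynomial.homogeneousSubmodule (Fin (n + 1)) k)
    (hφ' : HomogeneousIdeal.irrelevant (MvPolynomial.homogeneousSubmodule (Fin (n + 1)) k) ≤
      (HomogeneousIdeal.irrelevant (MvPolynomial.homogeneousSubmodule (Fin (n + 1)) O)).map φ)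
    (hφ : ∀ s, φ s = MvPolynomial.map π s)
    (Y : Set (AlgebraicGeometry.Proj (MvPolynomial.homogeneousSubmodule (Fin (n + 1)) O)))
    (hY : Y = Set.range (ι ≫ AlgebraicGeometry.Proj.map φ hφ' :
      H ⟶ AlgebraicGeometry.Proj (MvPolynomial.homogeneousSubmodule (Fin (n + 1)) O))) :
    ∃ (P' : AlgebraicGeometry.Scheme.{0}) (σ : P' ⟶ AlgebraicGeometry.Proj (MvPolynomial.homogeneousSubmodule (Fin (n + 1)) O))
      (S' : Set P'),
      (∀ Q : (∀ X' : AlgebraicGeometry.Scheme.{0},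
          (X' ⟶ AlgebraicGeometry.Proj (MvPolynomial.homogeneousSubmodule (Fin (n + 1)) O)) → Set X' → Prop),
        Q (AlgebraicGeometry.Proj (MvPolynomial.homogeneousSubmodule (Fin (n + 1)) O)) (𝟙 _) Y →
        (∀ (X' X'' : AlgebraicGeometry.Scheme.{0})
            (σ' : X' ⟶ AlgebraicGeometry.Proj (MvPolynomial.homogeneousSubmodule (Fin (n + 1)) O)) (Y' : Set X')
            (C : X'.IdealSheafData) (τ : X'' ⟶ X'),
          Q X' σ' Y' → IsBlowup τ C → Scheme.IsRegular C.subscheme →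
          AlgebraicGeometry.Flat (C.subschemeι ≫ σ' ≫
            (AlgebraicGeometry.Proj.toSpecZero (MvPolynomial.homogeneousSubmodule (Fin (n + 1)) O) ≫
              AlgebraicGeometry.Spec.map (CommRingCat.ofHom
                (algebraMap O (MvPolynomial.homogeneousSubmodule (Fin (n + 1)) O 0))))) →
          σ' '' (C.support : Set X') ⊆ {x | ¬ IsGenericPoint x Y} →
          (C.support : Set X') ∩ (σ' ≫
            (AlgebraicGeometry.Proj.toSpecZero (MvPolynomial.homogeneousSubmodule (Fin (n + 1)) O) ≫
              AlgebraicGeometry.Spec.map (CommRingCat.ofHom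
                (algebraMap O (MvPolynomial.homogeneousSubmodule (Fin (n + 1)) O 0))))) ⁻¹' {IsLocalRing.closedPoint O} ⊆ Y' →
          Q X'' (τ ≫ σ') (closure (τ ⁻¹' (Y' \ (C.support : Set X'))))) →
        Q P' σ S') ∧
      Scheme.IsRegular (vanishingIdeal (⟨closure S', isClosed_closure⟩ : Closeds P')).subscheme := by
  classical
  obtain ⟨s, hEF, hCS, hTOK⟩ := hD
  subst hY
  -- the ambient `P = ℙⁿ_O`, its structure morphism `q`, and the TOP SQUARES (E1)
  set q : Proj (homogeneousSubmodule (Fin (n + 1)) O) ⟶ Spec (.of O) :=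
    Proj.toSpecZero (homogeneousSubmodule (Fin (n + 1)) O) ≫
      Spec.map (CommRingCat.ofHom (algebraMap O (homogeneousSubmodule (Fin (n + 1)) O 0))) with hq
  set qB : Proj (homogeneousSubmodule (Fin (n + 1)) B) ⟶ Spec (.of B) :=
    Proj.toSpecZero (homogeneousSubmodule (Fin (n + 1)) B) ≫
      Spec.map (CommRingCat.ofHom (algebraMap B (homogeneousSubmodule (Fin (n + 1)) B 0))) with hqB
  -- `j : ℙⁿ_k → ℙⁿ_O`, the special fibre (the crux's `Proj.map φ`)
  have hP := ProjectiveAmbientFibre.isPullback_projMap π φ hφ hπ hφ'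
  set J : Proj (homogeneousSubmodule (Fin (n + 1)) k) ⟶ Proj (homogeneousSubmodule (Fin (n + 1)) O) :=
    Proj.map φ hφ' with hJ
  haveI : IsClosedImmersion (Spec.map (CommRingCat.ofHom π)) := IsClosedImmersion.spec_of_surjective _ hπ
  haveI hJci : IsClosedImmersion J := MorphismProperty.IsStableUnderBaseChange.of_isPullback hP.flip inferInstance
  -- `ι_O : ℙⁿ_O → ℙⁿ_B`, the base change of `Spec O → Spec B`
  set ιO : Proj (homogeneousSubmodule (Fin (n + 1)) O) ⟶ Proj (homogeneousSubmodule (Fin (n + 1)) B) :=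
    Proj.map (ProjBaseChangeRing.mapGraded B O (Fin (n + 1))) (ProjBaseChangeRing.irrelevant_le_map B O (Fin (n + 1))) with hιO
  have HO : IsPullback ιO q qB (specOfAlgebra B O) := ProjBaseChangeRing.isPullback_projMap' B O
  -- `ι_k := j ≫ ι_O = Proj.map (φ ∘ (B[x] → O[x]))`, in the pasted square over `Spec (π ∘ g)`
  set θ : B →+* k := π.comp (algebraMap B O) with hθ
  set ψ : homogeneousSubmodule (Fin (n + 1)) B →+*ᵍ homogeneousSubmodule (Fin (n + 1)) k :=
    φ.comp (ProjBaseChangeRing.mapGraded B O (Fin (n + 1))) with hψ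
  have hψθ : ∀ t, ψ t = MvPolynomial.map θ t := by
    intro t
    show φ (ProjBaseChangeRing.mapGraded B O (Fin (n + 1)) t) = MvPolynomial.map (π.comp (algebraMap B O)) t
    rw [ProjBaseChangeRing.mapGraded_apply, hφ, MvPolynomial.map_map]
  have hψ' : HomogeneousIdeal.irrelevant (homogeneousSubmodule (Fin (n + 1)) k) ≤
      (HomogeneousIdeal.irrelevant (homogeneousSubmodule (Fin (n + 1)) B)).map ψ :=
    HomogeneousIdeal.irrelevant_le_map_comp (ProjBaseChangeRing.irrelevant_le_map B O (Fin (n + 1))) hφ'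
  have hcompι : (Proj.map ψ hψ' : (Literature.AlgebraicGeometry.Motives.projectiveSpace n k).left ⟶
      Proj (homogeneousSubmodule (Fin (n + 1)) B)) = J ≫ ιO :=
    Proj.map_comp _ _ (ProjBaseChangeRing.irrelevant_le_map B O (Fin (n + 1))) hφ'
  have hsqk : IsPullback (Proj.map ψ hψ' : (Literature.AlgebraicGeometry.Motives.projectiveSpace n k).left ⟶
        Proj (homogeneousSubmodule (Fin (n + 1)) B))
      (Proj.toSpecZero (homogeneousSubmodule (Fin (n + 1)) k) ≫
        Spec.map (CommRingCat.ofHom (algebraMap k (homogeneousSubmodule (Fin (n + 1)) k 0))))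
      qB (Spec.map (CommRingCat.ofHom θ)) := by
    have e : Spec.map (CommRingCat.ofHom θ) = Spec.map (CommRingCat.ofHom π) ≫ specOfAlgebra B O := by
      rw [hθ, CommRingCat.ofHom_comp, Spec.map_comp]
    rw [hcompι, e]
    exact hP.paste_horiz HO
  -- the door's k-side certificate, CALLED on the standard fibre through `ℙⁿ_O`
  have hT : DescTransformOK (s.comap (Proj.map ψ hψ' :
      (Literature.AlgebraicGeometry.Motives.projectiveSpace n k).left ⟶ Proj (homogeneousSubmodule (Fin (n + 1)) B)))
      (𝟙 (Literature.AlgebraicGeometry.Motives.projectiveSpace n k).left) (Set.range ι) (Set.range ι) :=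
    hTOK θ ψ hψ' hψθ hsqk
  -- the closed image `Y = j '' range ι` lies in the special fibre
  let ι' : H ⟶ Proj (homogeneousSubmodule (Fin (n + 1)) k) := ι
  have hYc : J '' Set.range ι = Set.range (ι ≫ Proj.map φ hφ') := by
    rw [Scheme.Hom.comp_base, TopCat.coe_comp, Set.range_comp]; rfl
  have hrangeJ : Set.range J = q ⁻¹' {IsLocalRing.closedPoint O} := by
    rw [range_eq_preimage_of_isPullback hP, range_specMap_of_surjective_of_field π hπ]
  have hsub : Set.range (ι ≫ Proj.map φ hφ') ⊆ q ⁻¹' {IsLocalRing.closedPoint O} := by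
    rw [← hYc, ← hrangeJ]
    exact Set.image_subset_range _ _
  -- the ambient is smooth over `Spec O`, hence regular and locally Noetherian
  obtain ⟨hsm, -⟩ := stub_projectiveAmbientSmoothProper O n
  haveI := hsm
  have hPnoeth : IsLocallyNoetherian (Proj (homogeneousSubmodule (Fin (n + 1)) O)) :=
    LocallyOfFiniteType.isLocallyNoetherian q
  have hPreg : Scheme.IsRegular (Proj (homogeneousSubmodule (Fin (n + 1)) O)) := Scheme.IsRegular.of_smooth q hOreg
  -- EL♮'s HORIZONTAL induction principle as a stage predicate over the fixed base (K5′'s `⋂ Q` idiom)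
  obtain ⟨Ch, hCh⟩ : ∃ Ch : ∀ X' : Scheme.{0}, (X' ⟶ Proj (homogeneousSubmodule (Fin (n + 1)) O)) → Set X' → Prop,
      ∀ (X₁ : Scheme.{0}) (σ₁ : X₁ ⟶ Proj (homogeneousSubmodule (Fin (n + 1)) O)) (S₁ : Set X₁), Ch X₁ σ₁ S₁ ↔
      ∀ Q : (∀ X' : Scheme.{0}, (X' ⟶ Proj (homogeneousSubmodule (Fin (n + 1)) O)) → Set X' → Prop),
        Q (Proj (homogeneousSubmodule (Fin (n + 1)) O)) (𝟙 _) (Set.range (ι ≫ Proj.map φ hφ')) →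
        (∀ (X' X'' : Scheme.{0}) (σ' : X' ⟶ Proj (homogeneousSubmodule (Fin (n + 1)) O)) (Y' : Set X')
          (C : X'.IdealSheafData) (τ : X'' ⟶ X'), Q X' σ' Y' → IsBlowup τ C → Scheme.IsRegular C.subscheme →
          Flat (C.subschemeι ≫ σ' ≫ q) →
          σ' '' (C.support : Set X') ⊆ {x | ¬ IsGenericPoint x (Set.range (ι ≫ Proj.map φ hφ'))} →
          (C.support : Set X') ∩ (σ' ≫ q) ⁻¹' {IsLocalRing.closedPoint O} ⊆ Y' →
          Q X'' (τ ≫ σ') (closure (τ ⁻¹' (Y' \ (C.support : Set X'))))) →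
        Q X₁ σ₁ S₁ := ⟨_, fun _ _ _ => Iff.rfl⟩
  have hStep : ∀ (X' X'' : Scheme.{0}) (σ' : X' ⟶ Proj (homogeneousSubmodule (Fin (n + 1)) O)) (S' : Set X')
      (C : X'.IdealSheafData) (τ : X'' ⟶ X'),
      Ch X' σ' S' → IsBlowup τ C → Scheme.IsRegular C.subscheme → Flat (C.subschemeι ≫ σ' ≫ q) →
      σ' '' (C.support : Set X') ⊆ {x | ¬ IsGenericPoint x (Set.range (ι ≫ Proj.map φ hφ'))} →
      (C.support : Set X') ∩ (σ' ≫ q) ⁻¹' {IsLocalRing.closedPoint O} ⊆ S' →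
      Ch X'' (τ ≫ σ') (closure (τ ⁻¹' (S' \ (C.support : Set X')))) :=
    fun X' X'' σ' S' C τ h hb hr hfl hg' hE => (hCh _ _ _).mpr fun Q h0 hs =>
      hs X' X'' σ' S' C τ ((hCh X' σ' S').mp h Q h0 hs) hb hr hfl hg' hE
  have hCh₀ : Ch (Proj (homogeneousSubmodule (Fin (n + 1)) O)) (𝟙 _) (Set.range (ι ≫ Proj.map φ hφ')) :=
    (hCh _ _ _).mpr fun Q h0 _ => h0
  -- the seeds of the two chains
  have HO₀ : IsPullback ιO (𝟙 _ ≫ q) qB (specOfAlgebra B O) := by rw [Category.id_comp]; exact HO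
  have hsq₀ : IsPullback J (Proj.toSpecZero (homogeneousSubmodule (Fin (n + 1)) k) ≫
      Spec.map (CommRingCat.ofHom (algebraMap k (homogeneousSubmodule (Fin (n + 1)) k 0)))) (𝟙 _ ≫ q)
      (Spec.map (CommRingCat.ofHom π)) := by
    rw [Category.id_comp]; exact hP
  have hcomm₀ : J ≫ 𝟙 (Proj (homogeneousSubmodule (Fin (n + 1)) O)) =
      𝟙 (Literature.AlgebraicGeometry.Motives.projectiveSpace n k).left ≫ J := by
    rw [Category.comp_id]; exact (Category.id_comp _).symm
  -- ONE call of the chain (E2)–(E5)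
  obtain ⟨hTop, hEnd⟩ :=
    Descent.chain_of_descTransformOK O k π hπ (Proj (homogeneousSubmodule (Fin (n + 1)) O)) q
      (Set.range (ι ≫ Proj.map φ hφ')) hsub Ch hStep hOreg J (Set.range ι) hYc s qB ιO (𝟙 _)
      (Set.range (ι ≫ Proj.map φ hφ')) hCh₀ hPnoeth hPreg HO₀
      (Proj.map ψ hψ' : (Literature.AlgebraicGeometry.Motives.projectiveSpace n k).left ⟶
        Proj (homogeneousSubmodule (Fin (n + 1)) B))
      J _ hcompι.symm hsq₀ (𝟙 _) hcomm₀ (Set.range ι) hYc hEF hCS hT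
  exact ⟨_, _, _, fun Q h0 hs => (hCh _ _ _).mp hTop Q h0 hs, hEnd⟩

/-- ★★ **`descDoor_elnat` — THE D18 ENGINE: the descent-certificate door implies EL♮'s conclusion**, for every `n` and with no
hypothesis on `H`: `O := 𝕎(k)` with `π = constantCoeff` (✓ `DescBase.exists_base` over ✓ `stub_wittRing`; `N ∈ Oˣ` because
`π N = (N : k) ≠ 0` and `ker π = 𝔪_O`), `B := ℤ[1/N] → O` the `IsLocalization.Away` lift, then `descDoorOver_elnat_of_base`.
FACT-FREE (no `EmbeddedCurveLiftFact`). [cite: Serre1979, II §5–§6] [cite: Liu2002, Prop. 3.1.9 and Ex. 3.1.10]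
[OURS · L1 W4.5b · D18 engine]; NOT a statement of the manuscript; EL♮(3) NOT proved. -/
theorem descDoor_elnat (p : ℕ) (hp : p.Prime) (k : Type) [Field k] [CharP k p] [IsAlgClosed k] (n : ℕ)
    (H : AlgebraicGeometry.Scheme.{0}) (ι : H ⟶ (Literature.AlgebraicGeometry.Motives.projectiveSpace n k).left) :
    DescDoor k n H ι → ELNatConclusionO k n H ι := by
  classical
  rintro ⟨N, hN, hD⟩
  obtain ⟨O, i1, i2, i3, i4, i5, i6, π, hπ, -, hunit, -⟩ := DescBase.exists_base p hp k N hN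
  unfold ELNatConclusionO
  refine ⟨O, i1, i2, i3, i4, π, hπ, ?_⟩
  intro φ hφ' hφ Y hY
  -- `B = ℤ[1/N] → O`
  have hunit' : IsUnit (algebraMap ℤ O (N : ℤ)) := by simpa using hunit
  letI : Algebra (Localization.Away (N : ℤ)) O := (IsLocalization.Away.lift (N : ℤ) hunit').toAlgebra
  exact descDoorOver_elnat_of_base (Localization.Away (N : ℤ)) O (Scheme.isRegular_Spec (.of O)) k π hπ n H ι
    hD φ hφ' hφ Y hY

end Summit.ResolutionOfSingularities.ResolutionOfSingularities.Cruxes.EquisingularLiftNat.Sections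

end
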